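import Summits.HodgeConjecture.HodgeConjecture.Theorems.MilnorKExponentialSymbolClassesAlgebraicNashSymbolConiveauOne
import Literature.AlgebraicGeometry.FundamentalGroup.RiemannExistenceEtaleLocalHomeomorph
import Literature.AlgebraicGeometry.Motives.JacobianHomology
import Literature.AlgebraicGeometry.Motives.VarietiesProperProofs
import Literature.AlgebraicGeometry.HodgeTheory.WeightKillCupUnits
import Literature.AlgebraicTopology.SingularHomology.FiniteCoverTransfer

/-!
# Stub (W₁-band) `stub_nashWeightTwoBandDiesOffClosed` of the line `NashDescentSketch` — reduction to a globalisation statement and Deligne's weights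

Support file for the crux `SymbolClassesAlgebraic` (stmt-HodgeConjecture-17743, route
`MilnorKExponential`), line `NashDescentSketch`, band stub (W₁-band)
`stub_nashWeightTwoBandDiesOffClosed` (the hypothesis `h` of
`nashSymbolConiveauOne_low_weights_of_weightTwoBand`,
`Theorems/MilnorKExponentialSymbolClassesAlgebraicNashSymbolConiveauOne`): on a smooth projective
complex `n`-fold, `n ≥ 4`, every rational NASH symbol class `c ∈ H⁴(X(ℂ); ℂ)` of weight `2` dies
on `(X ∖ Z)(ℂ)` for some proper Zariski-closed `Z ⊊ X`.

The idea card (`Cruxes/SymbolClassesAlgebraic/Ideas/nash-descent-weight-kill.md`) proves this in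
two steps: (G) globalise the Nash units of the cocycle on a finite étale cover `φ : W → U` of a
non-empty Zariski-open `U = X ∖ D` (then, by the Čech–de Rham transgression, the pulled-back class
`(φ ≫ ι)^* c` is a combination of cup products `a ∪ (e₁ ∪ e₂)` of classes `a ∈ H²(W(ℂ); ℂ)` with
the classes `eᵢ = uᵢ^*[dz/z] ∈ H¹(W(ℂ); ℂ)` of GLOBAL units `uᵢ ∈ Γ(W, 𝒪_W)ˣ`), and (W) kill that
class by Deligne's weights (`a ∪ e₁` has weights `≥ 3`, `e₂` weight `2`, so the cup has weights
`≥ 5 > 4 =` the weight of a class coming from the smooth projective `X`; strictness), then descend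
along the finite covering `W(ℂ) → U(ℂ)` (transfer) to `U(ℂ) = (X ∖ D)(ℂ)`.

PROVED here (sorry-free):

* `restrictCompl_compl_opensRange_eq_zero_of_map_eq_zero` — for an open immersion `ι : U ⟶ X`, a
  class killed by `ι^*` dies on the complex points of the complement of `Z = X ∖ ι(U)` (the
  inclusion `(X ∖ Z)(ℂ) ↪ X(ℂ)` factors continuously through the open embedding `U(ℂ) ↪ X(ℂ)`,
  `AlgPoints.isOpenEmbedding_map_holds`);
* `complexBetti_map_eq_zero_of_finiteEtale` — for `φ : W ⟶ U` finite étale surjective over a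
  separated `U`, `φ(ℂ)` is a finite covering
  (`isCoveringMap_map_of_isFinite_of_etale_of_isSeparated`,
  `AlgPoints.map_surjective_of_surjective`), so `φ^*` is injective on `H^*(–(ℂ); ℂ)` (transfer,
  `IsFiniteCover.eq_zero_of_map_eq_zero`, Hatcher Prop. 3G.1);
* `nashWeightTwoBandDiesOffClosed_of_globalisation` (REGISTERED sub-goal) — the band stub FOLLOWS
  from (M1+M2) the globalisation statement `hG` (an explicit hypothesis, stated in the tree's
  vocabulary: open immersion `ι`, finite étale surjective `φ : W ⟶ U`, and
  `(φ ≫ ι)^* c ∈ ℂ-span {a ∪ (e₁ ∪ e₂)}` with `eᵢ` classes of global units of `W`) and (M3) the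
  named fact `HodgeTheory.deligne1971_weightKill_cupUnits`
  (`Literature/AlgebraicGeometry/HodgeTheory/WeightKillCupUnits`; Deligne, Hodge II 3.2.15–17 and
  III §8.2: weights kill the restriction of a class of `X` lying in the span of cup products with
  classes of units);
* `nashSymbolConiveauOne_low_weights_of_globalisation` — hence (W₁) in weights `≤ 2` under the same
  two hypotheses.

NOT here: (M1+M2) itself — the identity principle for Nash germs, normalisation / étale locus of
`X` in `ℂ(X)(t)`, lifting of the cover, and the multiplicativity of the Čech–de Rham zig-zag by a
global closed form (`isTransgression_cup`) with Čech-to-singular comparison in degree `2`; none has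
a carrier in the tree (report `work/stubs/NashWeightTwoBand-report.md`).

## References

* [DeligneHodgeII1971] P. Deligne, Théorie de Hodge II, Publ. Math. IHÉS 40 (1971), Thm. 2.3.5,
  Thm. 3.2.5, Cor. 3.2.15–3.2.17.
* [DeligneHodgeIII1974] P. Deligne, Théorie de Hodge III, Publ. Math. IHÉS 44 (1974), §8.2.
* [Dimca1992] A. Dimca, Singularities and Topology of Hypersurfaces (1992), App. C, (C22), (C24).
* [CattaniElZeinGriffithsLe2014] E. Cattani et al. (eds.), Hodge Theory (2014), Cor. 3.2.21,
  Def. 3.4.23, §3.4.2.12 Problem (2).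
* [HatcherAT2002] A. Hatcher, Algebraic Topology (2002), §3.G Prop. 3G.1.
* [SGA1] A. Grothendieck, SGA 1, Exp. XII Prop. 3.1 (iii), (xi) and Thm. 5.1.
-/

noncomputable section

open CategoryTheory AlgebraicGeometry Topology
open Literature.AlgebraicTopology.SingularHomology

-- `Summit.HodgeConjecture.HodgeConjecture.Theorems` is the mandated namespace (single-problem
-- summit), which `linter.dupNamespace` flags on every declaration.
set_option linter.dupNamespace false

namespace Summit.HodgeConjecture.HodgeConjecture.Theorems.MilnorKExponentialNash

open Literature.AlgebraicGeometry Literature.AlgebraicGeometry.HodgeTheory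
  Literature.AlgebraicGeometry.Motives

/-! ### Glue: open immersions and finite étale covers on complex points -/

/-- **A class killed by the pull-back along an open immersion `ι : U ⟶ X` dies on the complex
points of the complement of `Z = X ∖ ι(U)`**: the inclusion `(X ∖ Z)(ℂ) ↪ X(ℂ)` factors as a
continuous section `(X ∖ Z)(ℂ) → U(ℂ)` (lift of `ℂ`-points along `ι`,
`AlgPoints.liftOfMemOpensRange`, continuous because `ι(ℂ)` is an embedding,
`AlgPoints.isEmbedding_map`) followed by `ι(ℂ)`. [cite: SGA1, Exp. XII Prop. 3.1 (xi)] -/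
theorem restrictCompl_compl_opensRange_eq_zero_of_map_eq_zero {U X : SchemeOver ℂ} (ι : U ⟶ X)
    [IsOpenImmersion ι.left] {i : ℕ} {c : complexBetti X i} (hc : complexBetti.map ι i c = 0) :
    complexBetti.restrictCompl X ((ι.left.opensRange : Set X.left)ᶜ) i c = 0 := by
  have hmem : ∀ P : complexPointsCompl X ((ι.left.opensRange : Set X.left)ᶜ),
      P.1.pt ∈ ι.left.opensRange := fun P ↦ not_not.1 P.2
  set s₀ : complexPointsCompl X ((ι.left.opensRange : Set X.left)ᶜ) → ComplexPoints U :=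
    fun P ↦ AlgPoints.liftOfMemOpensRange ι P.1 (hmem P) with hs₀def
  have hs₀ : ∀ P, AlgPoints.map ι (s₀ P) = P.1 := fun P ↦
    AlgPoints.map_liftOfMemOpensRange ι P.1 (hmem P)
  have hcomp : (AlgPoints.map ι : ComplexPoints U → ComplexPoints X) ∘ s₀ = Subtype.val :=
    funext hs₀
  have hcont : Continuous s₀ := by
    rw [(AlgPoints.isEmbedding_map (L := ℂ) ι).continuous_iff, hcomp]
    exact continuous_subtype_val
  set s : C(complexPointsCompl X ((ι.left.opensRange : Set X.left)ᶜ), ComplexPoints U) :=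
    ⟨s₀, hcont⟩ with hsdef
  have hfac : (AlgPoints.mapContinuous (L := ℂ) ι).comp s =
      (⟨Subtype.val, continuous_subtype_val⟩ :
        C(complexPointsCompl X ((ι.left.opensRange : Set X.left)ᶜ), ComplexPoints X)) := by
    ext P : 1
    exact hs₀ P
  change singularCohomology.map ℂ ℂ (⟨Subtype.val, continuous_subtype_val⟩ :
      C(complexPointsCompl X ((ι.left.opensRange : Set X.left)ᶜ), ComplexPoints X)) i c = 0
  rw [← hfac, singularCohomology.map_comp, CategoryTheory.comp_apply]
  change singularCohomology.map ℂ ℂ s i (complexBetti.map ι i c) = 0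
  rw [hc, map_zero]

/-- **Pull-back along a finite étale surjective morphism is injective on `H^*(–(ℂ); ℂ)`**
(pointwise form): for `φ : W ⟶ U` finite, étale and surjective, `U` separated and locally of
finite type over `ℂ`, the map `φ(ℂ) : W(ℂ) → U(ℂ)` is a finite covering (a covering map with
finite fibres, `isCoveringMap_map_of_isFinite_of_etale_of_isSeparated`, onto,
`AlgPoints.map_surjective_of_surjective`), so the transfer retracts `φ^*`
(`IsFiniteCover.eq_zero_of_map_eq_zero`). [cite: HatcherAT2002, §3.G Prop. 3G.1]
[cite: SGA1, Exp. XII Prop. 3.1 (iii) and Thm. 5.1] -/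
theorem complexBetti_map_eq_zero_of_finiteEtale {W U : SchemeOver ℂ} (φ : W ⟶ U)
    [IsSeparated U.hom] [LocallyOfFiniteType U.hom] [IsFinite φ.left] [Etale φ.left]
    [AlgebraicGeometry.Surjective φ.left] {i : ℕ} {x : complexBetti U i}
    (hx : complexBetti.map φ i x = 0) : x = 0 := by
  haveI : LocallyOfFiniteType W.hom := by rw [← Over.w φ]; infer_instance
  obtain ⟨hcov, hfin⟩ :=
    FundamentalGroup.isCoveringMap_map_of_isFinite_of_etale_of_isSeparated φ
  have hφC : IsFiniteCover (AlgPoints.mapContinuous (L := ℂ) φ) :=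
    ⟨hcov, AlgPoints.map_surjective_of_surjective φ, hfin⟩
  exact hφC.eq_zero_of_map_eq_zero i hx

/-! ### The band stub from globalisation (M1+M2) and Deligne's weights (M3) -/

/-- **(W₁-band) from globalisation and weights.** Hypotheses: `hG` — (M1+M2), the GLOBALISATION
of a rational Nash symbol class of weight `2` on a smooth projective `n`-fold, `n ≥ 4`: there are a
non-empty open immersion `ι : U ⟶ X` and a finite étale surjective `φ : W ⟶ U` (so `W` is a
smooth variety of dimension `n`), such that `(φ ≫ ι)^* c` lies in the `ℂ`-span of the cup
products `a ∪ (e₁ ∪ e₂)`, `a ∈ H²(W(ℂ); ℂ)`, `eᵢ = uᵢ(ℂ)^* γᵢ` the classes of global units `uᵢ` of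
`W` (steps (G) and (C) of the card: the Nash units of the cocycle become global units on a finite
étale cover of the complement of the branch-and-pole divisor `D = X ∖ U`, and the transgression of
`Σ n • dlog u₁ ∧ dlog u₂` is `Σ [n] ∪ (e₁ ∪ e₂)`); `hW` — (M3), Deligne's weights
(`deligne1971_weightKill_cupUnits`). Conclusion: the registered band stub
`stub_nashWeightTwoBandDiesOffClosed` — `c` dies on `(X ∖ Z)(ℂ)`, `Z = X ∖ ι(U)` proper closed.
Proof: `a ∪ (e₁ ∪ e₂) = (a ∪ e₁) ∪ e₂` (`cupProduct_assoc`), so `(φ ≫ ι)^* c = 0` by `hW`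
(`d = 3`); `φ^*` is injective (`complexBetti_map_eq_zero_of_finiteEtale`), so `ι^* c = 0`; hence
`c` dies on `(X ∖ Z)(ℂ)` (`restrictCompl_compl_opensRange_eq_zero_of_map_eq_zero`).
[cite: DeligneHodgeII1971, Cor. 3.2.15–3.2.17] [cite: HatcherAT2002, §3.G Prop. 3G.1] -/
theorem nashWeightTwoBandDiesOffClosed_of_globalisation :
    (∀ ⦃n : ℕ⦄ ⦃X : SchemeOver ℂ⦄, IsSmoothProjective n X → 4 ≤ n →
      ∀ (c : complexBetti X (2 * (1 + 1))), IsRationalClass c → IsNashSymbolClass n X 1 c →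
        ∃ (U W : SchemeOver ℂ) (ι : U ⟶ X) (φ : W ⟶ U),
          IsOpenImmersion ι.left ∧ Nonempty U.left ∧ IsFinite φ.left ∧ Etale φ.left ∧
          AlgebraicGeometry.Surjective φ.left ∧
          complexBetti.map (φ ≫ ι) (2 * (1 + 1)) c ∈ Submodule.span ℂ
            {y : complexBetti W (2 * (1 + 1)) |
              ∃ (a : complexBetti W 2) (e₁ e₂ : complexBetti W 1),
                (∃ (u : Γ(W.left, ⊤)) (υ : C(ComplexPoints W, {z : ℂ // z ≠ 0}))
                    (γ : singularCohomology ℂ ℂ {z : ℂ // z ≠ 0} 1),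
                  IsUnit u ∧ (∀ P, (υ P : ℂ) = AlgPoints.evalOrZero ⊤ u P) ∧
                    e₁ = singularCohomology.map ℂ ℂ υ 1 γ) ∧
                (∃ (u : Γ(W.left, ⊤)) (υ : C(ComplexPoints W, {z : ℂ // z ≠ 0}))
                    (γ : singularCohomology ℂ ℂ {z : ℂ // z ≠ 0} 1),
                  IsUnit u ∧ (∀ P, (υ P : ℂ) = AlgPoints.evalOrZero ⊤ u P) ∧
                    e₂ = singularCohomology.map ℂ ℂ υ 1 γ) ∧
                y = cupProduct (rfl : 2 + 2 = 2 * (1 + 1)) a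
                  (cupProduct (rfl : 1 + 1 = 2) e₁ e₂)}) →
    deligne1971_weightKill_cupUnits →
    ∀ ⦃n : ℕ⦄ ⦃X : SchemeOver ℂ⦄, IsSmoothProjective n X → 4 ≤ n →
      ∀ (c : complexBetti X (2 * (1 + 1))), IsRationalClass c → IsNashSymbolClass n X 1 c →
        ∃ Z : Set X.left, IsClosed Z ∧ Z ≠ Set.univ ∧
          complexBetti.restrictCompl X Z (2 * (1 + 1)) c = 0 := by
  intro hG hW n X hX hn c hc hs
  obtain ⟨U, W, ι, φ, hι, ⟨u₀⟩, hφf, hφe, hφs, hspan⟩ := hG hX hn c hc hs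
  haveI := hι
  haveI := hφf
  haveI := hφe
  haveI := hφs
  -- instances: `X` proper, smooth; `U`, `W` separated, quasi-compact, smooth of dimension `n`
  haveI := hX.smoothOfRelativeDimension
  haveI : IsProper X.hom := hX.isProjectiveOver.isProper
  haveI : Smooth X.hom := SmoothOfRelativeDimension.smooth (n := n) (f := X.hom)
  haveI : IsLocallyNoetherian X.left := LocallyOfFiniteType.isLocallyNoetherian X.hom
  haveI : IsSeparated U.hom := by rw [← Over.w ι]; infer_instance
  haveI : LocallyOfFiniteType U.hom := by rw [← Over.w ι]; infer_instance
  haveI : QuasiCompact U.hom := by rw [← Over.w ι]; infer_instance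
  haveI : SmoothOfRelativeDimension n U.hom := by
    have h : SmoothOfRelativeDimension (0 + n) (ι.left ≫ X.hom) := inferInstance
    rwa [Nat.zero_add, Over.w ι] at h
  haveI : IsSeparated W.hom := by rw [← Over.w φ]; infer_instance
  haveI : QuasiCompact W.hom := by rw [← Over.w φ]; infer_instance
  have hWsm : SmoothOfRelativeDimension n W.hom := by
    have h : SmoothOfRelativeDimension (0 + n) (φ.left ≫ U.hom) := inferInstance
    rwa [Nat.zero_add, Over.w φ] at h
  -- (W) Deligne's weights: the class dies on `W` (`a ∪ (e₁ ∪ e₂) = (a ∪ e₁) ∪ e₂`, `d = 3`)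
  have hjW : complexBetti.map (φ ≫ ι) (2 * (1 + 1)) c = 0 := by
    refine hW hX hWsm (φ ≫ ι) 3 c hc (Submodule.span_mono ?_ hspan)
    rintro y ⟨a, e₁, e₂, -, he₂, rfl⟩
    exact ⟨cupProduct (rfl : 2 + 1 = 3) a e₁, e₂, he₂,
      (cupProduct_assoc (rfl : 2 + 1 = 3) (rfl : 1 + 1 = 2) (rfl : 3 + 1 = 2 * (1 + 1))
        (rfl : 2 + 2 = 2 * (1 + 1)) a e₁ e₂).symm⟩
  -- (transfer) the class dies on `U`
  have hιU : complexBetti.map ι (2 * (1 + 1)) c = 0 := by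
    refine complexBetti_map_eq_zero_of_finiteEtale φ ?_
    rw [← CategoryTheory.comp_apply, ← complexBetti.map_comp]
    exact hjW
  -- (descent to the complement) `Z = X ∖ ι(U)`
  refine ⟨(ι.left.opensRange : Set X.left)ᶜ, ι.left.opensRange.isOpen.isClosed_compl,
    fun hZ ↦ ?_, restrictCompl_compl_opensRange_eq_zero_of_map_eq_zero ι hιU⟩
  exact (Set.eq_univ_iff_forall.1 hZ (ι.left.base u₀)) ⟨u₀, rfl⟩

/-- **(W₁) in weights `≤ 2` from globalisation and weights**: under (M1+M2) and (M3) every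
rational Nash symbol class of weight `q + 1 ≤ 2` lies in `N¹ H^{2q+2}`
(`nashSymbolConiveauOne_low_weights_of_weightTwoBand` fed with
`nashWeightTwoBandDiesOffClosed_of_globalisation`).
[cite: DeligneHodgeII1971, Cor. 3.2.15–3.2.17] -/
theorem nashSymbolConiveauOne_low_weights_of_globalisation
    (hG : ∀ ⦃n : ℕ⦄ ⦃X : SchemeOver ℂ⦄, IsSmoothProjective n X → 4 ≤ n →
      ∀ (c : complexBetti X (2 * (1 + 1))), IsRationalClass c → IsNashSymbolClass n X 1 c →
        ∃ (U W : SchemeOver ℂ) (ι : U ⟶ X) (φ : W ⟶ U),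
          IsOpenImmersion ι.left ∧ Nonempty U.left ∧ IsFinite φ.left ∧ Etale φ.left ∧
          AlgebraicGeometry.Surjective φ.left ∧
          complexBetti.map (φ ≫ ι) (2 * (1 + 1)) c ∈ Submodule.span ℂ
            {y : complexBetti W (2 * (1 + 1)) |
              ∃ (a : complexBetti W 2) (e₁ e₂ : complexBetti W 1),
                (∃ (u : Γ(W.left, ⊤)) (υ : C(ComplexPoints W, {z : ℂ // z ≠ 0}))
                    (γ : singularCohomology ℂ ℂ {z : ℂ // z ≠ 0} 1),
                  IsUnit u ∧ (∀ P, (υ P : ℂ) = AlgPoints.evalOrZero ⊤ u P) ∧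
                    e₁ = singularCohomology.map ℂ ℂ υ 1 γ) ∧
                (∃ (u : Γ(W.left, ⊤)) (υ : C(ComplexPoints W, {z : ℂ // z ≠ 0}))
                    (γ : singularCohomology ℂ ℂ {z : ℂ // z ≠ 0} 1),
                  IsUnit u ∧ (∀ P, (υ P : ℂ) = AlgPoints.evalOrZero ⊤ u P) ∧
                    e₂ = singularCohomology.map ℂ ℂ υ 1 γ) ∧
                y = cupProduct (rfl : 2 + 2 = 2 * (1 + 1)) a
                  (cupProduct (rfl : 1 + 1 = 2) e₁ e₂)})
    (hW : deligne1971_weightKill_cupUnits)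
    ⦃n : ℕ⦄ ⦃X : SchemeOver ℂ⦄ (hX : IsSmoothProjective n X) (q : ℕ) (hq : q ≤ 1)
    (c : complexBetti X (2 * (q + 1))) (hc : IsRationalClass c) (hs : IsNashSymbolClass n X q c) :
    c ∈ supportedClasses X (2 * (q + 1)) 1 :=
  nashSymbolConiveauOne_low_weights_of_weightTwoBand
    (nashWeightTwoBandDiesOffClosed_of_globalisation hG hW) hX q hq c hc hs

end Summit.HodgeConjecture.HodgeConjecture.Theorems.MilnorKExponentialNash

end
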